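import Summits.BirchSwinnertonDyer.Rank1Residual.Partition.CornersCM
import Summits.BirchSwinnertonDyer.Rank1Residual.X12.CMGoodOrdinaryTwo
import HarnessLib

/-!
# Class 𝒞₇ (CM by `ℚ(√−7)`, `2 ∤ N`, every odd bad prime `≠ 7` split in `K`, analytic rank one): `BSD(E,p)` at EVERY prime `p ≠ 7`, so full BSD on 𝒞₇ ⟺ `BSD(E,7)` — a REMARK-level assembly (cell `bsd-cm`, seat `bsd-cm-plan`)

HONEST FRAMING (cell `bsd-cm`, run/shared/lean/pub/bsd-cm/, D-0033 tranche 1a; verbatim in every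
file of the cell): the programme isolates, for CM elliptic curves over `ℚ` of analytic rank `≤ 1`,
classes on which the FULL Birch–Swinnerton-Dyer formula is reduced — strictly by PUBLISHED theorems
entering as named-fact binders — to ONE local problem at ONE prime, and then TYPES that residual
problem (O10 inert-bad, O11 ramified, O12 `p = 2` non-split) for construction seats. This file is the
REMARK-level half for the class 𝒞₇ of the clean-class memo (pub/bsd-cleanclass-harvest/CLASS-MEMO.md
§2 (1)): it is BOOKKEEPING below five published named facts already in the tree and introduces NO
Literature statement and NO named fact. It is not "BSD for 𝒞₇" (the `7`-part is a CONSTRUCTION, not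
a combination — O11, ramified `p`-adic Gross–Zagier/BDP + descent; the signed main conjecture at a
ramified `p ≥ 5` is the pre-publication Burungale–Kobayashi–Nakamura–Ota arXiv:2608.06879 Thm. 1.7,
BSD application announced there as future work), not new at any single prime (each cell below is ONE
published theorem), and a referee would call the `∀ p ≠ 7` statement a remark.

THE CLASS (CLASS-MEMO §2, "CLASS 𝒞₇"): `E/ℚ` with CM field `K = ℚ(√−7)` (`j ∈ {−3375, 16581375}`,
`E ~ 49a1^{(D)}`), `2 ∤ N` (here: good ORDINARY reduction at `2` — for `K = ℚ(√−7)` the prime `2`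
splits, so good reduction at `2` is ordinary; conversely CM + good ordinary at `2` FORCES `d_K = −7`
by Deuring, `classCSeven_iff_of_deuring`), every odd bad prime `q ≠ 7` SPLIT in `K`
(`q ≡ 1, 2, 4 (mod 7)`), and `ord_{s=1} L(E,s) = 1`. In the tree's predicates
(`Rank1Residual.Predicates`): `ClassCSeven W := W.HasCM ∧ cmFieldDiscrOfJ W.j = −7 ∧ r_an = 1 ∧
GoodOrd W 2 ∧ ∀ q prime, q ≠ 7 → ¬ Good W q → CMSplit W q`. Members with `N < 5·10⁵` on the
harvest cell's Cremona extract: `5929e` (`D = −11`), `25921a` (`−23`), `219961e` (`−67`), `247009h`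
(`−71`), `305809c` (`−79`); infinitely many admissible `D` (Dirichlet), `r_an = 1` for infinitely
many of them EXPECTED, not located in print (flag INF-𝒞₇ of the memo).

WHAT IS PROVED HERE (kernel, no `sorry`, no new axiom), granted the five named facts of the CM rows of
the partition — the CM rank-`0` triple `hCM : bsdTriple_of_hasCM_of_L_one_ne_zero` (Rubin 1991 /
Burungale–Flach 2024) with modularity `hmod : hasEntireLFunction_rat`, Li–Liu–Tian 2024 Thm. 1.1 (i)
`hLLT` (odd split `p`, any reduction), Kobayashi 2013 Cor. 1.4 `hKob` (odd good `p`), Li–Tian–Yan–Zhu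
2025 Thm. 1.1 `hLTYZ` (`p = 2` good ordinary):
* `bsdp_cm_of_goodOrd_two_of_badSplit` — the ONE-PRIME-DIRTY LEMMA: a CM curve of analytic rank `≤ 1`
  with good ordinary reduction at `2` whose bad primes other than `p₀` are all split in `K` satisfies
  Miller's `BSD(E,p)` at every prime `p ≠ p₀` (it is never in the sharp CM corner `CornerF♯ W p` of
  `Partition/CornersCM` there: `not_cornerFSharp_of_goodOrd_two_of_badSplit`);
* `ClassCSeven.bsdp_of_ne_seven` — on 𝒞₇, `BSD(E,p)` for every prime `p ≠ 7`;
* `ClassCSeven.cornerFSharp_iff_eq_seven` — on 𝒞₇ the residual CM corner is EXACTLY the pair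
  `(E,7)` (`7` ramified ⇒ bad, not split), an X12 pair of the ramified sub-corner K12r = O11
  (`ClassCSeven.classX12_seven`, `ClassCSeven.cmRamified_seven`);
* `ClassCSeven.forall_bsdp_iff_bsdp_seven` — FULL BSD in Miller's prime-by-prime currency
  (`∀ p, BSD(E,p)`) ⟺ `BSD(E,7)`; and `ClassCSeven.forall_bsdp_of_missingPPartAt_seven` — the typed
  residue: the single missing input is `Typed.MissingPPartAt W 7` (`#Ш_an ∈ ℚ`, `ord₇ #Ш_an = ord₇ #Ш`),
  granted Gross–Zagier–Kolyvagin `hGZK`;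
* `classCSeven_iff_of_deuring` — granted Deuring's criterion `hDeu`, the clause `d_K = −7` is REDUNDANT
  (CM ∧ good ordinary at `2` ⇒ `K = ℚ(√−7)`), so membership is: CM, `r_an = 1`, good ordinary at `2`,
  odd bad primes `≠ 7` split.

WHY BOOK IT (memo §2): after Li–Tian–Yan–Zhu 2025 the whole formula for a rank-one CM curve in the
unique CM field where `2` SPLITS is reduced to one local problem at one fixed prime (`7`: `E[7]`
reducible, potentially supersingular, ramified) — the crisp one-prime TARGET of the cell's O11 seat
(HOME/TARGET.md §O11). No paper states the reduction "full BSD ⟺ BSD(E,7) on 𝒞₇" or the class; its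
value is the target, not a publication.

References: Li–Tian–Yan–Zhu, PAMQ 21 (2025), doi:10.4310/pamq.251115004959, Thm. 1.1 (ii)
[LiTianYanZhu2025]; Li–Liu–Tian, Sci. Sinica Math. 54 (2024) = arXiv:1605.01481, Thm. 1.1 (i)
[LiLiuTian2024]; Kobayashi, Invent. Math. 191 (2013) Cor. 1.4 [Kobayashi2013]; Rubin, Invent. Math. 103
(1991) Thm. 11.1 + Remark 3 [Rubin1991MainConj]; Burungale–Flach, Camb. J. Math. 12 (2024) Thm. 1.1 +
Cor. 2 [BurungaleFlach2024]; Miller, LMS J. Comput. Math. 14 (2011) Def. 1.1 [Miller2011LMS]; Lang,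
*Elliptic Functions* Ch. 13 §4 Thm. 12 [Lang1987]; Cox, *Primes of the form x² + ny²* §5.B
[Cox2013]; Burungale–Kobayashi–Nakamura–Ota, arXiv:2608.06879 (2026, PRE; context only, nothing used).
-/

set_option autoImplicit false

noncomputable section

open scoped Classical

open WeierstrassCurve Literature.NumberTheory.EllipticCurves
  Literature.NumberTheory.EllipticCurves.Rank1Residual
  Literature.NumberTheory.EllipticCurves.BurungaleCastellaSkinnerTian2022

namespace Summit.BirchSwinnertonDyer.Rank1Residual.X12

section Curve

variable {W : WeierstrassCurve ℚ} [W.IsElliptic] [W.IsGloballyMinimal]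

/-! ## §1 The one-prime-dirty lemma on the CM axis -/

/-- **Never in the sharp CM corner away from `p₀`**: if `W` has good ordinary reduction at `2` and
every bad prime `q ≠ p₀` is split in the CM field, then for every prime `p ≠ p₀` the pair `(W, p)` is
NOT in `CornerF♯ W p` (`p = 2` would need "not good ordinary at `2`"; an odd `p` would need a bad
non-split prime `≠ p₀`). [folklore] -/
theorem not_cornerFSharp_of_goodOrd_two_of_badSplit {p p₀ : ℕ} [Fact p.Prime] (hgo : GoodOrd W 2)
    (hsplit : ∀ (q : ℕ) [Fact q.Prime], q ≠ p₀ → ¬ Good W q → CMSplit W q) (hp : p ≠ p₀) :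
    ¬ CornerFSharp W p := by
  rintro ⟨-, -, h⟩
  rcases h with ⟨-, hngo⟩ | ⟨-, hns, hng⟩
  · exact hngo hgo
  · exact hns (hsplit p hp hng)

/-- **ONE-PRIME-DIRTY LEMMA (CM axis).** Granted the five named published facts of the CM rows
(`hCM`+`hmod` row C8, `hLLT` row C17, `hKob` row C10, `hLTYZ` T18): a CM curve `W/ℚ` (globally
minimal model) of analytic rank `≤ 1`, with good ORDINARY reduction at `2`, all of whose bad primes
other than `p₀` are SPLIT in the CM field, satisfies Miller's `BSD(E,p)` at EVERY prime `p ≠ p₀` —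
by `bsdp_cm_of_not_cornerFSharp` (Partition/CornersCM). [folklore] -/
theorem bsdp_cm_of_goodOrd_two_of_badSplit (hCM : bsdTriple_of_hasCM_of_L_one_ne_zero)
    (hmod : hasEntireLFunction_rat) (hLLT : LiLiuTian2024.thm11_bsdp_of_cm_rank_one)
    (hKob : Kobayashi2013.cor14_bsdp_of_cm_rank_one)
    (hLTYZ : LiTianYanZhu2025.thm11_bsdp_of_cm_rank_one) {p p₀ : ℕ} [Fact p.Prime]
    (hcm : W.HasCM) (hr : W.analyticRank ≤ 1) (hgo : GoodOrd W 2)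
    (hsplit : ∀ (q : ℕ) [Fact q.Prime], q ≠ p₀ → ¬ Good W q → CMSplit W q) (hp : p ≠ p₀) :
    BSDp W p :=
  bsdp_cm_of_not_cornerFSharp hCM hmod hLLT hKob hLTYZ hcm hr
    (not_cornerFSharp_of_goodOrd_two_of_badSplit hgo hsplit hp)

/-! ## §2 The class 𝒞₇ -/

variable (W) in
/-- **CLASS 𝒞₇** (CLASS-MEMO §2): CM with CM field `ℚ(√−7)` (`d_K = cmFieldDiscrOfJ W.j = −7`, i.e.
`j ∈ {−3375, 16581375}`), analytic rank one, good ordinary reduction at `2` (`2 ∤ N`; ordinarity is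
automatic since `2` splits in `ℚ(√−7)`, and conversely forces `d_K = −7`: `classCSeven_iff_of_deuring`),
and every bad prime `q ≠ 7` split in `K` (`q ≡ 1, 2, 4 (mod 7)`; `q = 2` is good anyway).
[folklore] -/
def ClassCSeven : Prop :=
  W.HasCM ∧ cmFieldDiscrOfJ W.j = -7 ∧ W.analyticRank = 1 ∧ GoodOrd W 2 ∧
    ∀ (q : ℕ) [Fact q.Prime], q ≠ 7 → ¬ Good W q → CMSplit W q

namespace ClassCSeven

/-- `7` is ramified in the CM field of a 𝒞₇ curve (`7 ∣ d_K = −7`). [cite: Cox2013, §5.B Prop. 5.16 and Cor. 5.17] -/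
theorem cmRamified_seven (h : ClassCSeven W) : CMRamified W 7 := by
  rw [CMRamified, h.2.1]
  norm_num

/-- … hence `7` is NOT split in `K`. [folklore] -/
theorem not_cmSplit_seven (h : ClassCSeven W) : ¬ CMSplit W 7 :=
  fun hs => hs.1 (cmRamified_seven h)

/-- … and `7` is a BAD (additive) prime of a 𝒞₇ curve (CM + odd ramified ⇒ bad, tree
`X12.not_good_of_cmRamified`). [cite: SilvermanATAEC1994, Thm. II.6.4 (PDF p. 148)] -/
theorem not_good_seven [Fact (7 : ℕ).Prime] (h : ClassCSeven W) : ¬ Good W 7 :=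
  not_good_of_cmRamified W 7 h.1 (by decide) (cmRamified_seven h)

/-- **On 𝒞₇ the sharp CM corner is exactly the pair `(E, 7)`.** [folklore] -/
theorem cornerFSharp_iff_eq_seven (h : ClassCSeven W) {p : ℕ} [hp : Fact p.Prime] :
    CornerFSharp W p ↔ p = 7 := by
  constructor
  · intro hc
    by_contra hne
    exact not_cornerFSharp_of_goodOrd_two_of_badSplit h.2.2.2.1 h.2.2.2.2 hne hc
  · rintro rfl
    exact ⟨h.1, h.2.2.1, Or.inr ⟨by decide, not_cmSplit_seven h, not_good_seven h⟩⟩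

/-- The residual pair `(E, 7)` of a 𝒞₇ curve is an X12 pair (ramified sub-corner K12r = the cell's
O11). [folklore] -/
theorem classX12_seven [Fact (7 : ℕ).Prime] (h : ClassCSeven W) : ClassX12 W 7 :=
  ⟨h.1, h.2.2.1, Or.inr (Or.inr (Or.inl (cmRamified_seven h)))⟩

/-- **𝒞₇: `BSD(E,p)` AT EVERY PRIME `p ≠ 7`** — `p = 2` by Li–Tian–Yan–Zhu 2025 Thm. 1.1 (ii)
(good ordinary at `2`), odd good `p` by Kobayashi 2013 Cor. 1.4, odd bad `p ≠ 7` (split) by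
Li–Liu–Tian 2024 Thm. 1.1 (i); assembled through the one-prime-dirty lemma. [folklore] -/
theorem bsdp_of_ne_seven (hCM : bsdTriple_of_hasCM_of_L_one_ne_zero)
    (hmod : hasEntireLFunction_rat) (hLLT : LiLiuTian2024.thm11_bsdp_of_cm_rank_one)
    (hKob : Kobayashi2013.cor14_bsdp_of_cm_rank_one)
    (hLTYZ : LiTianYanZhu2025.thm11_bsdp_of_cm_rank_one) (h : ClassCSeven W) {p : ℕ}
    [Fact p.Prime] (hp : p ≠ 7) : BSDp W p :=
  bsdp_cm_of_goodOrd_two_of_badSplit hCM hmod hLLT hKob hLTYZ h.1 h.2.2.1.le h.2.2.2.1 h.2.2.2.2 hp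

/-- **FULL BSD ON 𝒞₇ ⟺ `BSD(E,7)`** (Miller's prime-by-prime currency: `BSD(E,p)` at every prime
`p`). The right-hand side is CONSTRUCTION-shaped (O11: ramified `7`-adic Gross–Zagier/BDP formula +
descent; nothing in print). [folklore] -/
theorem forall_bsdp_iff_bsdp_seven (hCM : bsdTriple_of_hasCM_of_L_one_ne_zero)
    (hmod : hasEntireLFunction_rat) (hLLT : LiLiuTian2024.thm11_bsdp_of_cm_rank_one)
    (hKob : Kobayashi2013.cor14_bsdp_of_cm_rank_one)
    (hLTYZ : LiTianYanZhu2025.thm11_bsdp_of_cm_rank_one) (h : ClassCSeven W) :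
    (∀ p : ℕ, p.Prime → BSDp W p) ↔ BSDp W 7 := by
  refine ⟨fun hall => hall 7 (by norm_num), fun h7 p hp => ?_⟩
  by_cases hp7 : p = 7
  · subst hp7; exact h7
  · haveI : Fact p.Prime := ⟨hp⟩
    exact bsdp_of_ne_seven hCM hmod hLLT hKob hLTYZ h hp7

/-- **The typed residue of 𝒞₇**: granted in addition Gross–Zagier–Kolyvagin (`hGZK`: `rank = r_an`,
`Ш` finite in analytic rank `≤ 1`), the SINGLE missing input for full BSD on 𝒞₇ is the typed output
`Typed.MissingPPartAt W 7` — `#Ш_an ∈ ℚ` with `ord₇ #Ш_an = ord₇ #Ш(E/ℚ)`. [cite: Miller2011LMS, Def. 1.1] -/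
theorem forall_bsdp_of_missingPPartAt_seven (hCM : bsdTriple_of_hasCM_of_L_one_ne_zero)
    (hmod : hasEntireLFunction_rat) (hLLT : LiLiuTian2024.thm11_bsdp_of_cm_rank_one)
    (hKob : Kobayashi2013.cor14_bsdp_of_cm_rank_one)
    (hLTYZ : LiTianYanZhu2025.thm11_bsdp_of_cm_rank_one)
    (hGZK : rank_eq_analyticRank_of_analyticRank_le_one) (h : ClassCSeven W)
    (hmiss : Typed.MissingPPartAt W 7) (p : ℕ) (hp : p.Prime) : BSDp W p := by
  haveI : Fact (7 : ℕ).Prime := ⟨by norm_num⟩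
  exact (forall_bsdp_iff_bsdp_seven hCM hmod hLLT hKob hLTYZ h).2
    (Typed.bsdp_of_missingPPartAt W 7 hGZK h.2.2.1.le hmiss) p hp

/-- Equivalently with the typed X12 input `Typed.X12.MissingInputAt W 7` (which at the non-split
prime `7` is just `MissingPPartAt W 7`). [cite: Miller2011LMS, Def. 1.1] -/
theorem forall_bsdp_of_missingInputAt_seven (hCM : bsdTriple_of_hasCM_of_L_one_ne_zero)
    (hmod : hasEntireLFunction_rat) (hLLT : LiLiuTian2024.thm11_bsdp_of_cm_rank_one)
    (hKob : Kobayashi2013.cor14_bsdp_of_cm_rank_one)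
    (hLTYZ : LiTianYanZhu2025.thm11_bsdp_of_cm_rank_one)
    (hGZK : rank_eq_analyticRank_of_analyticRank_le_one) (h : ClassCSeven W)
    [Fact (7 : ℕ).Prime] (hmiss : Typed.X12.MissingInputAt W 7) (p : ℕ) (hp : p.Prime) :
    BSDp W p :=
  forall_bsdp_of_missingPPartAt_seven hCM hmod hLLT hKob hLTYZ hGZK h
    (hmiss fun hs => not_cmSplit_seven h hs.2) p hp

end ClassCSeven

/-! ## §3 The `d_K = −7` clause is forced (Deuring) -/

/-- **Membership without naming the field**: granted Deuring's criterion (`hDeu`, Lang Ch. 13 §4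
Thm. 12: CM and `p` not split ⇒ no unit root at `p`), a CM curve with good ORDINARY reduction at `2`
has CM field `ℚ(√−7)` (tree `cmFieldDiscrOfJ_eq_of_goodOrd_two`), so 𝒞₇ = "CM, `r_an = 1`, good
ordinary at `2`, every bad prime `≠ 7` split in `K`". [cite: Lang1987, Ch. 13 §4 Thm. 12] -/
theorem classCSeven_iff_of_deuring (hDeu : deuring_not_hasUnitRootAt_of_hasCM_of_not_cmSplit) :
    ClassCSeven W ↔ W.HasCM ∧ W.analyticRank = 1 ∧ GoodOrd W 2 ∧
      ∀ (q : ℕ) [Fact q.Prime], q ≠ 7 → ¬ Good W q → CMSplit W q := by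
  constructor
  · rintro ⟨hcm, -, hr1, hgo, hs⟩
    exact ⟨hcm, hr1, hgo, hs⟩
  · rintro ⟨hcm, hr1, hgo, hs⟩
    exact ⟨hcm, cmFieldDiscrOfJ_eq_of_goodOrd_two hDeu W hcm hgo.1 hgo.2, hr1, hgo, hs⟩

/-- **The one-prime-dirty lemma has content only at `p₀ = 7`** (granted Deuring): a CM curve with
good ordinary reduction at `2` has `K = ℚ(√−7)`, in which `7` is ramified, hence bad and not split —
so "every bad prime `≠ p₀` is split" with `p₀ ≠ 7` is impossible. [cite: Lang1987, Ch. 13 §4 Thm. 12] -/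
theorem eq_seven_of_goodOrd_two_of_badSplit (hDeu : deuring_not_hasUnitRootAt_of_hasCM_of_not_cmSplit)
    {p₀ : ℕ} (hcm : W.HasCM) (hgo : GoodOrd W 2)
    (hsplit : ∀ (q : ℕ) [Fact q.Prime], q ≠ p₀ → ¬ Good W q → CMSplit W q) : p₀ = 7 := by
  haveI : Fact (7 : ℕ).Prime := ⟨by norm_num⟩
  have hK : cmFieldDiscrOfJ W.j = -7 := cmFieldDiscrOfJ_eq_of_goodOrd_two hDeu W hcm hgo.1 hgo.2
  have hram : CMRamified W 7 := by rw [CMRamified, hK]; norm_num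
  by_contra hne
  exact (hsplit 7 (Ne.symm hne) (not_good_of_cmRamified W 7 hcm (by decide) hram)).1 hram

end Curve

end Summit.BirchSwinnertonDyer.Rank1Residual.X12

end
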